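import Mathlib
import HarnessLib

/-!
# ζ(5) search — digit inequalities, Legendre transcriptions and the level assembly behind the odd denominators on the Catalan-box rays (cell `pub-zeta5`, fam-denom K6, serving fam-catalan K6b♯♯ / F15)
HONEST FRAMING: systematic search; no irrationality claim unless certified. Nothing in this file mentions Catalan's
constant or an irrationality statement; it is elementary arithmetic of residues.

Context (`families/denom/CATK6.md`). On the rays `(H,J,K,L,M) = (n, jn, n, (j+1)n, n)` of the five-parameter Catalan box
`J = Q·G + P` (`Literature.NumberTheory.Irrationality.Nesterenko2016.Jsym`), CATK6 proves on paper
`d*_{(j+1)n} · d*_{max(jn,4n−1)} · P_n ∈ ℤ[½]` (fam-catalan's observed laws F1′/F15; `d*_N` = lcm of the odd numbers `≤ N`)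
from a truncation-free pole expansion ("sliding expansion point") whose terms have `p`-adic valuations given, prime power
by prime power (`q = p^t`), by three DIGIT FUNCTIONS of the residues `x = n mod q`, `y = c mod q` or `a mod q`,
`z = (jn−c) mod q` or `(a+jn) mod q` (CATK6 §4, θ-form):
* `F = [z<x] − ⌊(y+2x)/q⌋ + θ(x) + θ(z) + θ({(x+y)/q}) + θ(y)`            (type α terms),
* `H = θ(x) + θ(z) + [z<x] + θ({(x−y)/q}) − θ(y) − ⌊(2x−y)/q⌋`            (type β terms),
* `G = θ(x) + θ(z) + [z<x] − θ(y) − θ({(y−x)/q}) − ⌊(2x−y)/q⌋ − [y=x]`    (type γ terms),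
where `θ(u) := [2u ≥ q]` for a residue `u` and `{·}` is the fractional part, written out below without division.
The whole proof of CATK6 Theorem K6 rests on SEVEN inequalities for these functions (F0, F1, F2, H0, H1, G1, G0), each
with a three-line proof on paper and a brute-force check over all residues; THIS FILE PROVES ALL SEVEN for all `q, x, y, z`
(linear arithmetic after case splits: `omega`; the residue bounds not needed by a particular inequality are kept,
underscored, to document the setting) — Part A. Part B proves the ONE-LEVEL LEGENDRE TRANSCRIPTIONS: for every `q > 0`
(odd for β, γ) the floor forms `FdigFloor`, `HdigFloor`, `GdigFloor` — the level-`q` slices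
`Σ ± ⌊N_i/q⌋` of `v_p` of the three factorial quotients of CATK6 §2/§4 (ten resp. ten resp. eleven Legendre quotients) —
EQUAL `Fdig`, `Hdig`, `Gdig` of the residues (`FdigFloor_eq`, `HdigFloor_eq`, `GdigFloor_eq`), whence the floor-form
inequalities (`FdigFloor_nonneg`, `HdigFloor_nonneg`, `GdigFloor_ge_neg_one`; F1/F2/H1/G0 transfer the same way).
Part C sums the levels with Mathlib's `padicValNat_factorial` (Legendre): the `p`-adic valuations `vAlpha`, `vBeta`,
`vGamma` of the three FACTORIAL QUOTIENTS (numerator minus denominator, as integers) equal the level sums of the floor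
forms (`vAlpha_eq_sum`, `vBeta_eq_sum`, `vGamma_eq_sum`), whence `vAlpha ≥ 0` at EVERY prime (the type-α factorial part
is an integer), `vBeta ≥ 0` and `vGamma ≥ −⌊log_p(2a−1)⌋` at odd primes. Part D is the level-by-level ASSEMBLY of CATK6 §5
on the rays with `J := jn ≥ 3n` (i.e. `j ≥ 3`; only `J ≥ 3n` is used): with the allowance `[q ≤ J+n] + [q ≤ max(J,4n−1)]`
per level and the atom costs of CATK6 §3 charged per level (`gsum` 2 and `W` 2, `σ` 1 at the levels `q ≤ 2c−1` resp.
`q ≤ 2a−1`, `Λ` 1 at the levels `q ≤ 2X−1`), the per-level inequalities `levelAlpha/BetaB/BetaA/Gamma` and the summed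
TERM BOUNDS `termAlpha/BetaB/BetaA/Gamma`: `v_p(factorial part) − cost·⌊log_p N⌋ ≥ −(⌊log_p (J+n)⌋ + ⌊log_p max(J,4n−1)⌋)`,
the right-hand side being `−v_p(d*_{(j+1)n} d*_{max(jn,4n−1)})` for odd `p`.
What is NOT typed here (prover work; pattern `FactorialRatioPrimeClasses`): the closed forms of the pole coefficients of
`R_n` as (power of 2) × (these factorial quotients) × (the atoms) (CATK6 §2), the atom valuation bounds
`v_p(gsum_c) ≥ −2⌊log_p(2c−1)⌋`, `v_p(W_a) ≥ −2⌊log_p(2a−1)⌋`, `v_p(σ_a) ≥ −⌊log_p(2a−1)⌋`, `v_p(Λ_a) ≥ −⌊log_p(2X−1)⌋`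
(CATK6 §3 / CATK1 L5–L7), the `j ∈ {1,2}` variant of §5 (Remark 5.3), and the identification of `P` with the tree's
`catalanP` (needs the `Jsym` series development). Staged by the fam-denom planner seat (no stage permission); to be
filed verbatim by the lane.
FILE LAYOUT (400-line lint): this file = the digit functions, Part A (tight digit inequalities) and Part B for
type α (`FdigFloor_eq`); `CatalanRayDigitsB` = Part B for types β/γ (generic one-level Legendre lemmas,
`HdigFloor_eq`, `GdigFloor_eq`); `CatalanRayDigitsC` = Parts C–D (level sums `vAlpha/vBeta/vGamma` and the
per-term allowances `termAlpha/termBetaB/termBetaA/termGamma`).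
-/

namespace Summit.KontsevichZagierPeriods.Zeta5Search.Denom.CatalanRayDigits

/-- Iverson bracket as an integer. -/
def ind (P : Prop) [Decidable P] : ℤ := if P then 1 else 0

/-- `θ(x/q) = [2x ≥ q]` for a residue `x`. -/
def th (q x : ℕ) : ℤ := ind (q ≤ 2 * x)

/-- `θ` of the fractional part of `(x+y)/q` for residues `x, y < q`. -/
def thAdd (q x y : ℕ) : ℤ := if x + y < q then ind (q ≤ 2 * (x + y)) else ind (3 * q ≤ 2 * (x + y))

/-- `θ` of the fractional part of `(x−y)/q` for residues `x, y < q`. -/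
def thSub (q x y : ℕ) : ℤ := if y ≤ x then ind (q + 2 * y ≤ 2 * x) else ind (2 * y ≤ 2 * x + q)

/-- `⌊(y+2x)/q⌋ ∈ {0,1,2}` for residues `x, y < q`. -/
def carryF (q x y : ℕ) : ℤ := ind (q ≤ y + 2 * x) + ind (2 * q ≤ y + 2 * x)

/-- `⌊(2x−y)/q⌋ ∈ {−1,0,1}` for residues `x, y < q`. -/
def carry2 (q x y : ℕ) : ℤ := ind (q + y ≤ 2 * x) - ind (2 * x < y)

/-- Digit function of the type-α terms (CATK6 §4): `x = n mod q`, `y = c mod q`, `z = (jn−c) mod q`. -/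
def Fdig (q x y z : ℕ) : ℤ := ind (z < x) - carryF q x y + th q x + th q z + thAdd q y x + th q y

/-- Digit function of the type-β terms: `x = n mod q`, `y = a mod q` (`a ≤ n`), `z = (a+jn) mod q`. -/
def Hdig (q x y z : ℕ) : ℤ := th q x + th q z + ind (z < x) + thSub q x y - th q y - carry2 q x y

/-- Digit function of the type-γ terms: `x = n mod q`, `y = a mod q` (`n < a ≤ 2n`), `z = (a+jn) mod q`. -/
def Gdig (q x y z : ℕ) : ℤ :=
  th q x + th q z + ind (z < x) - th q y - thSub q y x - carry2 q x y - ind (y = x)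

/-- (F0) `F ≥ 0`. -/
theorem F0 (q x y z : ℕ) (_hx : x < q) (hy : y < q) (_hz : z < q) : 0 ≤ Fdig q x y z := by
  unfold Fdig carryF thAdd th ind
  split_ifs <;> omega

/-- (F1) if `ν < ½`, `γ ≥ ½`, `γ + ν < 1` then `F ≥ 1` (levels `q ∈ (jn, (j+1)n]`, `j ≥ 4`). -/
theorem F1 (q x y z : ℕ) (_hx : x < q) (_hy : y < q) (_hz : z < q)
    (hν : 2 * x < q) (hγ : q ≤ 2 * y) (hγν : x + y < q) : 1 ≤ Fdig q x y z := by
  unfold Fdig carryF thAdd th ind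
  split_ifs <;> omega

/-- (F2) if `γ ≥ ½` and `γ + 2ν < 1` then `F ≥ 2` (levels `q > (j+1)n` with `q ≤ 2c−1`). -/
theorem F2 (q x y z : ℕ) (_hx : x < q) (hy : y < q) (_hz : z < q)
    (hγ : q ≤ 2 * y) (h : y + 2 * x < q) : 2 ≤ Fdig q x y z := by
  unfold Fdig carryF thAdd th ind
  split_ifs <;> omega

/-- (H0) `H ≥ 0`. -/
theorem H0 (q x y z : ℕ) (_hx : x < q) (hy : y < q) (hz : z < q) : 0 ≤ Hdig q x y z := by
  unfold Hdig carry2 thSub th ind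
  split_ifs <;> omega

/-- (H1) if `ν < ¼`, `α ≤ ν`, `ξ ≥ ½` then `H ≥ 1` (the level `q ∈ ((j+1)n, 2X−1]`). -/
theorem H1 (q x y z : ℕ) (_hx : x < q) (hy : y < q) (hz : z < q)
    (hν : 4 * x < q) (hα : y ≤ x) (hξ : q ≤ 2 * z) : 1 ≤ Hdig q x y z := by
  unfold Hdig carry2 thSub th ind
  split_ifs <;> omega

/-- (G1) `G ≥ −1`. -/
theorem G1 (q x y z : ℕ) (_hx : x < q) (hy : y < q) (hz : z < q) : -1 ≤ Gdig q x y z := by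
  unfold Gdig carry2 thSub th ind
  split_ifs <;> omega

/-- (G0) if `ν < ¼` and `ν < α ≤ 2ν` then `G ≥ 0` (levels `q > (j+1)n ≥ 4n`). -/
theorem G0 (q x y z : ℕ) (_hx : x < q) (hy : y < q) (hz : z < q)
    (hν : 4 * x < q) (hα1 : x < y) (hα2 : y ≤ 2 * x) : 0 ≤ Gdig q x y z := by
  unfold Gdig carry2 thSub th ind
  split_ifs <;> omega

/-- Tightness: the minima `F = 0`, `H = 0`, `G = −1` are attained (so the constants in CATK6 §5 cannot be improved
termwise). -/
theorem digits_tight : Fdig 3 0 0 0 = 0 ∧ Hdig 3 0 0 0 = 0 ∧ Gdig 3 1 1 1 = -1 := by decide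


/-! ### Part B — Legendre transcription at one level, type α (pattern for the typer)

For `q = p^t` the level-`t` contribution of `v_p` of the type-α term's factorial quotient
`(2n)!(2m)!(2c+2n)!(2c)! / (n! m! (c+n)!² c! (m−n)! (c+2n)!)` (CATK6 §2, `m = jn−c ≥ n`) is the FLOOR form
`FdigFloor` below (Legendre: `v_p(N!) = Σ_t ⌊N/p^t⌋`); we prove it equals `Fdig` of the residues. -/

/-- Floor form of the type-α digit function at level `q` (ten Legendre quotients). -/
def FdigFloor (q n c m : ℕ) : ℤ :=
  (((2 * n) / q : ℕ) : ℤ) - ((n / q : ℕ) : ℤ) + (((2 * m) / q : ℕ) : ℤ) - ((m / q : ℕ) : ℤ)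
    + (((2 * (c + n)) / q : ℕ) : ℤ) - 2 * (((c + n) / q : ℕ) : ℤ) + (((2 * c) / q : ℕ) : ℤ) - ((c / q : ℕ) : ℤ)
    - (((m - n) / q : ℕ) : ℤ) - (((c + 2 * n) / q : ℕ) : ℤ)

/-- `⌊(qk + r)/q⌋ = k` for `r < q` (cast to `ℤ`). -/
lemma cdiv1 (q k r : ℕ) (hq : 0 < q) (hr : r < q) : (((q * k + r) / q : ℕ) : ℤ) = k := by
  rw [show q * k + r = r + q * k by ring, Nat.add_mul_div_left r k hq, Nat.div_eq_of_lt hr]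
  simp

/-- `⌊r/q⌋` for `r < 4q`, written with Iverson brackets. -/
lemma cdiv_small (q r : ℕ) (hq : 0 < q) (hr : r < 4 * q) :
    ((r / q : ℕ) : ℤ) = ind (q ≤ r) + ind (2 * q ≤ r) + ind (3 * q ≤ r) := by
  have h1 := Nat.div_add_mod r q
  have h2 := Nat.mod_lt r hq
  have h3 : r / q < 4 := Nat.div_lt_of_lt_mul (by omega)
  generalize r / q = d at *
  unfold ind
  interval_cases d <;> split_ifs <;> omega

/-- `⌊(qk + r)/q⌋` for `r < 4q`: `k` plus the Iverson brackets `[q ≤ r] + [2q ≤ r] + [3q ≤ r]`. -/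
lemma cdiv4 (q k r : ℕ) (hq : 0 < q) (hr : r < 4 * q) :
    (((q * k + r) / q : ℕ) : ℤ) = k + ind (q ≤ r) + ind (2 * q ≤ r) + ind (3 * q ≤ r) := by
  rw [show q * k + r = r + q * k by ring, Nat.add_mul_div_left r k hq, Nat.cast_add,
    cdiv_small q r hq hr]
  ring

/-- One-level Legendre slice of `(2N)!/N!` at `q`: `⌊2N/q⌋ − ⌊N/q⌋ = k + θ_q(x)` for `N = qk + x`, `x < q`. -/
lemma compA (q k x : ℕ) (hq : 0 < q) (hx : x < q) :
    (((2 * (q * k + x)) / q : ℕ) : ℤ) - (((q * k + x) / q : ℕ) : ℤ) = k + th q x := by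
  rw [show 2 * (q * k + x) = q * (2 * k) + 2 * x by ring, cdiv4 q (2 * k) (2 * x) hq (by omega),
    cdiv1 q k x hq hx]
  unfold th ind
  push_cast
  split_ifs <;> omega

/-- One-level slice of `(2(N+D))!/((N+D)! D!)`-type quotients: quotient parts plus `θ_q` of the wrapped residue and the carry. -/
lemma compM (q kn x kd w : ℕ) (hq : 0 < q) (hx : x < q) (hw : w < q) :
    (((2 * (q * kn + x + (q * kd + w))) / q : ℕ) : ℤ) - (((q * kn + x + (q * kd + w)) / q : ℕ) : ℤ)
      - (((q * kd + w) / q : ℕ) : ℤ)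
      = kn + th q (if x + w < q then x + w else x + w - q)
          + ind ((if x + w < q then x + w else x + w - q) < x) := by
  rw [show 2 * (q * kn + x + (q * kd + w)) = q * (2 * (kn + kd)) + 2 * (x + w) by ring,
    show q * kn + x + (q * kd + w) = q * (kn + kd) + (x + w) by ring,
    cdiv4 q (2 * (kn + kd)) (2 * (x + w)) hq (by omega), cdiv4 q (kn + kd) (x + w) hq (by omega),
    cdiv1 q kd w hq hw]
  unfold th ind
  push_cast
  split_ifs <;> omega

/-- One-level slice of `(2M)!/M!²` at `q` for `M = qK + (y + x)`: equals `thAdd q y x` (digit doubling with carry). -/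
lemma compCN (q K y x : ℕ) (hq : 0 < q) (hy : y < q) (hx : x < q) :
    (((2 * (q * K + (y + x))) / q : ℕ) : ℤ) - 2 * (((q * K + (y + x)) / q : ℕ) : ℤ) = thAdd q y x := by
  rw [show 2 * (q * K + (y + x)) = q * (2 * K) + 2 * (y + x) by ring,
    cdiv4 q (2 * K) (2 * (y + x)) hq (by omega), cdiv4 q K (y + x) hq (by omega)]
  unfold thAdd ind
  push_cast
  split_ifs <;> omega

/-- Legendre transcription, type α, explicit parametrisation by quotients and residues. -/
theorem FdigFloor_eq_aux (q kn x kc y kd w : ℕ) (hq : 0 < q) (hx : x < q) (hy : y < q) (hw : w < q) :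
    FdigFloor q (q * kn + x) (q * kc + y) (q * kn + x + (q * kd + w))
      = Fdig q x y (if x + w < q then x + w else x + w - q) := by
  have hA := compA q kn x hq hx
  have hC := compA q kc y hq hy
  have hM := compM q kn x kd w hq hx hw
  have hCN : (((2 * (q * kc + y + (q * kn + x))) / q : ℕ) : ℤ)
      - 2 * (((q * kc + y + (q * kn + x)) / q : ℕ) : ℤ) = thAdd q y x := by
    rw [show q * kc + y + (q * kn + x) = q * (kc + kn) + (y + x) by ring]
    exact compCN q (kc + kn) y x hq hy hx
  have hE : (((q * kc + y + 2 * (q * kn + x)) / q : ℕ) : ℤ) = (kc : ℤ) + 2 * (kn : ℤ) + carryF q x y := by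
    rw [show q * kc + y + 2 * (q * kn + x) = q * (kc + 2 * kn) + (y + 2 * x) by ring,
      cdiv4 q (kc + 2 * kn) (y + 2 * x) hq (by omega)]
    unfold carryF ind
    push_cast
    split_ifs <;> omega
  have hsub : q * kn + x + (q * kd + w) - (q * kn + x) = q * kd + w := Nat.add_sub_cancel_left _ _
  have hD : (((q * kd + w) / q : ℕ) : ℤ) = kd := cdiv1 q kd w hq hw
  have hc1 : (((q * kc + y) / q : ℕ) : ℤ) = kc := cdiv1 q kc y hq hy
  unfold FdigFloor
  rw [hsub]
  unfold Fdig
  linarith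

/-- Legendre transcription, type α (CATK6 §4): at every level `q`, for `n ≤ m`, the floor form equals the residue
form. -/
theorem FdigFloor_eq (q n c m : ℕ) (hq : 0 < q) (hnm : n ≤ m) :
    FdigFloor q n c m = Fdig q (n % q) (c % q) (m % q) := by
  obtain ⟨d, rfl⟩ := Nat.exists_eq_add_of_le hnm
  have key := FdigFloor_eq_aux q (n / q) (n % q) (c / q) (c % q) (d / q) (d % q) hq
    (Nat.mod_lt _ hq) (Nat.mod_lt _ hq) (Nat.mod_lt _ hq)
  simp only [Nat.div_add_mod] at key
  rw [key]
  have h1 := Nat.mod_lt n hq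
  have h2 := Nat.mod_lt d hq
  congr 1
  rw [Nat.add_mod]
  split_ifs with h
  · exact (Nat.mod_eq_of_lt h).symm
  · rw [Nat.mod_eq_sub_mod (show q ≤ n % q + d % q by omega),
      Nat.mod_eq_of_lt (show n % q + d % q - q < q by omega)]

/-- Hence the per-level inequality in floor form: the type-α Legendre digit sum is `≥ 0` at every level (F0). -/
theorem FdigFloor_nonneg (q n c m : ℕ) (hq : 0 < q) (hnm : n ≤ m) : 0 ≤ FdigFloor q n c m := by
  rw [FdigFloor_eq q n c m hq hnm]
  exact F0 q _ _ _ (Nat.mod_lt _ hq) (Nat.mod_lt _ hq) (Nat.mod_lt _ hq)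

end Summit.KontsevichZagierPeriods.Zeta5Search.Denom.CatalanRayDigits
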